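import Summits.ResolutionOfSingularities.ResolutionOfSingularities.Theorems.HilbertSamuelEliminationSigmaMaxModificationsCorridor3WLadderMovingTwoCensus2
import HarnessLib

/-!
# [OURS · L1 W4.2] The one-step strata kernels (K-ctr-pt) / (K-ctr-cv) in STRATEGY-FREE («bare») form — bricks for the E-port
# `StrataCentreMembersCleanFromσE` of (K-ctr) to boundary-reading strategies (crux `SigmaMaxModifications` stmt-ResolutionOfSingularities-18506 /
# conjunct stmt-…-19249, line `w_ladder`, CORE (W) binder; `--supports 19249`, helper)

Seat res-D-pv-038 (gen 9), res-L1-w42-plan-1 desk assignment 2026-08-27T16:15:26Z «(K-ctr)From_h = the E-PORT `StrataCentreMembersCleanFromσE`».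
Sorry-free PROOF file, no definition, no named fact beyond the (F1♯) doors and CJS Thm. 3.6 taken BY NAME. OURS bookkeeping for the W4.2 crux
chain (cell res-hironaka); NOT a statement of [Hironaka2017] nor of [CossartJannsenSaito2020]. AI-written; AI review is weaker than expert review.

The tree's one-step kernels behind (K-ctr) — res-L1-w42-stub-4's `StepProjection.pointGerm_members_clean_geomDir` (point germ of the centre,
`…StrataCentrePointGermGeomDir`) and `strataCurveCentreDominantClean_of_geomDir` (curve germ, `…StrataCentreCurveDominantCleanGeomDir`, the β-twin
of this seat's p527476) — are typed against the CJS oracle `R` (`StepProjection R`, `IsCanonicalStep R`, `CycleInv`/`StateGood`), although their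
geometric content only needs: the step IS the blow-up `Bℓ_C(X_n) → X_n` read at a closed near point, `C` permissible inside `X_n(ν)`, and the
stages are maximal origins (finite type over a field, reduced, `dim ≤ 3`, `ν` maximal). This file re-proves them in that BARE form — the
step data `(L′, P′, x′)` with `s′ = ⟨Bℓ_C, _, L′, P′, x′⟩`, `f = eqToHom ≫ π_C` passed explicitly, the stages as `IsMaximalOrigin p 3 ν` —
so that ANY step relation (the oracle's `CanonicalNearStep R`, the σ-layer's `CanonicalNearStepσE σ`) feeds them:

* §0 plumbing for the bare step (`base_pt`, `isBlowup`);
* §1 `pointGerm_members_clean_bare` — stub-4's localisation proof verbatim after its first five lines;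
* §2 `curveGerm_dominant_clean_bare` — stub-4's curve-germ proof verbatim with the stage facts supplied by `IsMaximalOrigin` (through
  `IsMaximalOrigin.exists_cycleInv` at the initial marked stage, whose conclusions only mention `W` and `pt`).

The dispatch and the σE row are in the companion `…Corridor3WLadderHybridLowCentreClean`.

[OURS · L1 W4.2; AI-written] [cite: CossartJannsenSaito2020, Thm. 3.14, Thm. 3.6, Prop. 6.31, Def. 6.38 (ii), Rem. 6.29 (1)]
-/

noncomputable section

-- plan-1/idea-2 module setting kept (namespace `…Corridor3.Moving` re-enters `…Corridor3`)
set_option linter.dupNamespace false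

open CategoryTheory CategoryTheory.Limits AlgebraicGeometry TopologicalSpace Topology IsLocalRing
open Summit.ResolutionOfSingularities.ResolutionOfSingularities.Theorems.CampaignW42
open Literature.AlgebraicGeometry.Resolution Literature.RingTheory.HilbertSamuel
open Literature.AlgebraicGeometry.CossartJannsenSaito2020
open Summit.ResolutionOfSingularities.ResolutionOfSingularities.Theorems.SigmaMaxModificationsCorridor3
open Scheme.IdealSheafData

universe u

namespace Summit.ResolutionOfSingularities.ResolutionOfSingularities.Theorems.SigmaMaxModificationsCorridor3.Moving

variable {N : ℕ} {ν : ℕ → ℕ}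

/-! ## §0. The bare step: `s′ = (Bℓ_C(X_n), L′, P′, x′)`, `f = π_C` -/

/-- The bare step maps the marked point to the marked point. [folklore] -/
theorem bareStep_base_pt {s s' : MarkedStage.{u}} {f : s'.W ⟶ s.W} {C : s.W.IdealSheafData}
    {h : IsLocallyNoetherian (blowup C)} {L' : Labelling (blowup C)} {P' : Option (Pending (blowup C))} {x' : ↥(blowup C)}
    (hπ : (blowup.π C).base x' = s.pt) (e : s' = ⟨blowup C, h, L', P', x'⟩)
    (hfe : f = eqToHom (congrArg MarkedStage.W e) ≫ blowup.π C) : f.base s'.pt = s.pt := by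
  subst e
  subst hfe
  simpa using hπ

/-- The bare step is a blow-up in `C`. [folklore] -/
theorem bareStep_isBlowup {s s' : MarkedStage.{u}} {f : s'.W ⟶ s.W} {C : s.W.IdealSheafData}
    {h : IsLocallyNoetherian (blowup C)} {L' : Labelling (blowup C)} {P' : Option (Pending (blowup C))} {x' : ↥(blowup C)}
    (e : s' = ⟨blowup C, h, L', P', x'⟩) (hfe : f = eqToHom (congrArg MarkedStage.W e) ≫ blowup.π C) :
    IsBlowup f C := by
  haveI : IsLocallyNoetherian s.W := s.ln
  rw [hfe]
  exact (blowup.isBlowup C).iso_comp (eqToIso (congrArg MarkedStage.W e))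

/-! ## §1. (K-ctr-pt) bare: point germ of the centre, `e = 2` -/

/-- **(K-ctr-pt) ALONG ONE BARE STEP** (modulo `ProjDir_projLine`, `Thm314_point_locus_geomDir`): for the blow-down `f : Bℓ_C(X_n) ⟶ X_n` read at a
closed near point `x′ ↦ x_n`, with `C` regular permissible, `x_n ∈ V(C)` having POINT GERM there, `X_n` excellent Noetherian of dimension `≤ N`,
(F1♯) at `x_n ∈ X_n(ν)`, `X_{n+1}(ν)` closed and `e_{x_n} = 2`: the components of `X_{n+1}(ν)` through `x′` over `x_n` number at most one and are
regular curves at `x′`. Stub-4's `StepProjection.pointGerm_members_clean_geomDir` with the step passed bare (its proof verbatim: localise at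
`x_n`, res-D-pv-038's point-centre theorem on `Spec 𝒪_{X_n,x_n}`, transport back). [cite: CossartJannsenSaito2020, Thm. 3.14, Def. 6.38 (ii), Prop. 6.31, p. 107] -/
theorem pointGerm_members_clean_bare (hPa : ProjDir_projLine.{u}) (h314pt : Thm314_point_locus_geomDir.{u})
    {s s' : MarkedStage.{u}} {f : s'.W ⟶ s.W} {C : s.W.IdealSheafData}
    (hf : ∃ (L' : Labelling (blowup C)) (P' : Option (Pending (blowup C))) (h : IsLocallyNoetherian (blowup C)) (x' : ↥(blowup C)),
      (blowup.π C).base x' = s.pt ∧ IsClosed ({x'} : Set ↥(blowup C)) ∧ x' ∈ Scheme.hsStratum (blowup C) N ν ∧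
        ∃ e : s' = ⟨blowup C, h, L', P', x'⟩, f = eqToHom (congrArg MarkedStage.W e) ≫ blowup.π C)
    [IsNoetherian s.W] (hs'N : IsNoetherian s'.W) (hexcW : Scheme.IsExcellent s.W)
    (hdimW : topologicalKrullDim s.W ≤ (N : WithBot ℕ∞)) (hgdh : @GeomDirHypothesis s.W s.ln s.pt)
    (hptn : s.pt ∈ Scheme.hsStratum s.W N ν) (hY'cl : IsClosed (Scheme.hsStratum s'.W N ν))
    (hCreg : Scheme.IsRegular C.subscheme) (hCperm : IdealSheafData.IsPermissible C) (hxC : s.pt ∈ (C.support : Set s.W))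
    (hgerm : ∀ a ∈ (C.support : Set s.W), a ⤳ s.pt → a = s.pt) (he : dirDim s = 2) :
    (∀ Z' ∈ componentsThrough N ν s', ∀ Z'' ∈ componentsThrough N ν s',
        f.base '' Z' ⊆ {s.pt} → f.base '' Z'' ⊆ {s.pt} → Z' = Z'') ∧
      ∀ Z' ∈ componentsThrough N ν s', f.base '' Z' ⊆ {s.pt} → IsRegularCurveAt s' Z' := by
  haveI := s.ln
  -- pass to the chosen blow-up
  obtain ⟨L', P₂, hln, x', hπ, hcl, hx', e, rfl⟩ := hf
  subst e
  simp only [eqToHom_refl, Category.id_comp]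
  haveI : IsLocallyNoetherian (blowup C) := hln
  haveI : IsNoetherian (blowup C) := hs'N
  have hY'cl' : IsClosed (Scheme.hsStratum (blowup C) N ν) := hY'cl
  -- the localisation `ι₀ : Spec 𝒪_{W,x_n} → W` and the base-changed step
  haveI : IsProper (blowup.π C) := (blowup.isBlowup C).isProper
  set ι₀ := s.W.fromSpecStalk s.pt with hι₀
  haveI : Flat ι₀ := flat_fromSpecStalk s.W s.pt
  set P := pullback (blowup.π C) ι₀ with hP
  set j : P ⟶ blowup C := pullback.fst (blowup.π C) ι₀ with hj
  set πP : P ⟶ Spec (s.W.presheaf.stalk s.pt) := pullback.snd (blowup.π C) ι₀ with hπP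
  have hsq : j ≫ blowup.π C = πP ≫ ι₀ := pullback.condition
  haveI : IsLocallyNoetherian P := LocallyOfFiniteType.isLocallyNoetherian πP
  -- the centre pulls back to the closed point
  set o := closedPoint (s.W.presheaf.stalk s.pt) with ho
  have hoc : IsClosed ({o} : Set ↥(Spec (s.W.presheaf.stalk s.pt))) := isClosed_singleton_closedPoint _
  let Co : Closeds ↥(Spec (s.W.presheaf.stalk s.pt)) := ⟨{o}, hoc⟩
  have hι₀o : ι₀.base o = s.pt := Scheme.fromSpecStalk_closedPoint
  haveI := hCreg.isReduced
  have hCv : C = Scheme.IdealSheafData.vanishingIdeal C.support := by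
    have h1 : C = (⊥ : C.subscheme.IdealSheafData).map C.subschemeι := by
      rw [Scheme.IdealSheafData.map_bot, Scheme.IdealSheafData.ker_subschemeι]
    have h2 : (⊥ : C.subscheme.IdealSheafData) = Scheme.IdealSheafData.vanishingIdeal ⊤ := by
      rw [Scheme.IdealSheafData.vanishingIdeal_top, Scheme.nilradical_eq_bot]
    rw [h1, h2, Scheme.IdealSheafData.map_vanishingIdeal]
    congr 1
  have hpre : C.support.preimage ι₀.continuous = Co := by
    apply Closeds.ext
    ext q
    change ι₀.base q ∈ (C.support : Set s.W) ↔ q ∈ ({o} : Set _)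
    constructor
    · intro hq'
      have hqx : ι₀.base q = s.pt := hgerm _ hq' (fromSpecStalk_specializes q)
      exact ι₀.isEmbedding.injective (hqx.trans hι₀o.symm)
    · rintro rfl
      rw [hι₀o]; exact hxC
  have hcomapC : C.comap ι₀ = Scheme.IdealSheafData.vanishingIdeal Co := by
    conv_lhs => rw [hCv]
    rw [comap_vanishingIdeal_eq_of_flat_of_isPreimmersion ι₀ C.support, hpre]
  have hbl : IsBlowup πP (Scheme.IdealSheafData.vanishingIdeal Co) :=
    hcomapC ▸ (blowup.isBlowup C).pullback_snd_of_flat ι₀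
  -- the marked point of `P` over `x'` and `o`
  have hx'o : (blowup.π C).base x' = ι₀.base o := by rw [hπ, hι₀o]
  obtain ⟨q, hjq, hπPq⟩ := Scheme.Pullback.exists_preimage_pullback (f := blowup.π C) (g := ι₀) x' o hx'o
  let sP : MarkedStage.{u} := ⟨P, inferInstance, Labelling.init P, none, q⟩
  -- hypotheses of the point-centre theorem on `Spec 𝒪_{W,x_n}`
  haveI := isIso_stalkMap_of_flat_of_isPreimmersion ι₀ o
  have hexc : Scheme.IsExcellent (Spec (s.W.presheaf.stalk s.pt)) :=
    Scheme.isExcellent_Spec_of_isExcellentRing _ (isExcellentRing_stalk_of_isExcellent hexcW s.pt)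
  have hperm : IdealSheafData.IsPermissible (Scheme.IdealSheafData.vanishingIdeal Co) :=
    hcomapC ▸ isPermissible_comap_of_flat_of_isPreimmersion ι₀ C hCperm
  have hdim : topologicalKrullDim ↥(Spec (s.W.presheaf.stalk s.pt)) ≤ (N : WithBot ℕ∞) :=
    ι₀.isEmbedding.isInducing.topologicalKrullDim_le.trans hdimW
  have hgdhP : GeomDirHypothesis (Spec (s.W.presheaf.stalk s.pt)) o := by
    have hκ : ringChar (ResidueField ((Spec (s.W.presheaf.stalk s.pt)).presheaf.stalk o)) =
        ringChar (ResidueField (s.W.presheaf.stalk s.pt)) := by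
      rw [Helpers.ringChar_residueField_eq_of_hom' ι₀ o, hι₀o]
    have hgd : Scheme.geomDirDim (Spec (s.W.presheaf.stalk s.pt)) o = Scheme.geomDirDim s.W s.pt := by
      rw [Scheme.geomDirDim_eq_of_isIso_stalkMap ι₀ o, hι₀o]
    unfold GeomDirHypothesis at hgdh ⊢
    rw [hκ, hgd]
    exact hgdh
  have hνP : Scheme.hsFun (Spec (s.W.presheaf.stalk s.pt)) N o = ν := by
    rw [Scheme.hsFun_eq_of_isIso_stalkMap ι₀ N o, hι₀o]
    exact Scheme.mem_hsStratum_iff.mp hptn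
  have heP : Scheme.dirDim (Spec (s.W.presheaf.stalk s.pt)) o = 2 := by
    rw [Scheme.dirDim_eq_of_isIso_stalkMap ι₀ o, hι₀o]
    exact he
  -- the stratum of `P` is the preimage of the stratum of `Bl`, hence closed
  have hstrP : Scheme.hsStratum P N ν = j.base ⁻¹' Scheme.hsStratum (blowup C) N ν := by
    ext z
    haveI := isIso_stalkMap_of_flat_of_isPreimmersion j z
    rw [Scheme.mem_hsStratum_iff, Set.mem_preimage, Scheme.mem_hsStratum_iff, Scheme.hsFun_eq_of_isIso_stalkMap j N z]
  have hWc : IsClosed (Scheme.hsStratum sP.W N ν) := by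
    change IsClosed (Scheme.hsStratum P N ν)
    rw [hstrP]; exact hY'cl'.preimage j.continuous
  -- res-D-pv-038's theorem on the localised step
  obtain ⟨huniq, hregP⟩ := strataCentreMembersClean_pointCase_geomDir (N := N) (ν := ν) hPa h314pt sP πP hoc hexc hperm hbl hdim
    hgdhP hνP heP hWc
  -- members over `x_n` correspond to members of `P` through `q` over `o`
  have hrange : (blowup.π C).base ⁻¹' {s.pt} ⊆ Set.range j.base := by
    intro z hz
    rw [hj, Scheme.Pullback.range_fst]
    exact ⟨o, hι₀o.trans (Set.mem_singleton_iff.mp hz).symm⟩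
  have hmem : ∀ Z' ∈ componentsThrough N ν
      (⟨blowup C, hln, L', P₂, x'⟩ : MarkedStage.{u}),
      (blowup.π C).base '' Z' ⊆ {s.pt} →
      j.base ⁻¹' Z' ∈ componentsThrough N ν sP ∧ πP.base '' (j.base ⁻¹' Z') ⊆ {o} ∧ Z' ⊆ Set.range j.base := by
    intro Z' hZ' hZ'x
    have hZ'r : Z' ⊆ Set.range j.base := fun z hz => hrange (hZ'x ⟨z, hz, rfl⟩)
    have hZ'irr : IsIrreducible Z' := componentsIn.isIrreducible hZ'.1
    refine ⟨⟨?_, ?_⟩, ?_, hZ'r⟩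
    · -- a component of the stratum of `P`
      refine mem_componentsIn_iff.mpr ⟨?_, isIrreducible_preimage_of_isEmbedding j.isEmbedding hZ'irr hZ'r, ?_⟩
      · change j.base ⁻¹' Z' ⊆ Scheme.hsStratum P N ν
        rw [hstrP]; exact Set.preimage_mono (componentsIn.subset hZ'.1)
      · intro T hT hTirr hsub
        -- `closure j(T)` is irreducible, inside the (closed) stratum, and contains `Z′`
        have h1 : Z' ⊆ closure (j.base '' T) := by
          intro z hz
          obtain ⟨t, rfl⟩ := hZ'r hz
          exact subset_closure ⟨t, hsub hz, rfl⟩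
        have h2 : closure (j.base '' T) ⊆ Scheme.hsStratum (blowup C) N ν := by
          refine closure_minimal ?_ hY'cl'
          rintro _ ⟨t, ht, rfl⟩
          have := hT ht
          change t ∈ Scheme.hsStratum P N ν at this
          rw [hstrP] at this
          exact this
        have h3 : closure (j.base '' T) = Z' :=
          ((mem_componentsIn_iff.mp hZ'.1).2.2 _ h2 ((hTirr.image _ j.continuous.continuousOn).closure) h1).antisymm h1
        intro t ht
        show j.base t ∈ Z'
        rw [← h3]; exact subset_closure ⟨t, ht, rfl⟩
    · show q ∈ j.base ⁻¹' Z'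
      rw [Set.mem_preimage, hjq]; exact hZ'.2
    · rintro _ ⟨t, ht, rfl⟩
      have h1 : ι₀.base (πP.base t) = s.pt := by
        have := congrArg (fun φ => φ.base t) hsq
        change ((j ≫ blowup.π C).base t) = ((πP ≫ ι₀).base t) at this
        rw [Scheme.Hom.comp_apply, Scheme.Hom.comp_apply] at this
        rw [← this]; exact hZ'x ⟨_, ht, rfl⟩
      exact ι₀.isEmbedding.injective (h1.trans hι₀o.symm)
  refine ⟨fun Z' hZ' Z'' hZ'' h' h'' => ?_, fun Z' hZ' h' => ?_⟩
  · obtain ⟨hm', ho', hr'⟩ := hmem Z' hZ' h'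
    obtain ⟨hm'', ho'', hr''⟩ := hmem Z'' hZ'' h''
    have heq := huniq _ hm' _ hm'' ho' ho''
    rw [← Set.image_preimage_eq_of_subset hr', ← Set.image_preimage_eq_of_subset hr'']
    exact congrArg _ heq
  · obtain ⟨hm', ho', -⟩ := hmem Z' hZ' h'
    have hregZ := hregP _ hm' ho'
    exact isRegularCurveAt_of_preimage (s := ⟨blowup C, hln, L', P₂, x'⟩)
      (s' := sP) j hjq hcl (componentsIn.isIrreducible hZ'.1) (componentsIn.isClosed hY'cl' hZ'.1) hregZ

/-! ## §2. (K-ctr-cv) bare: curve germ of the centre — the dominant of the centre component through `x_n` -/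

/-- **(K-ctr-cv) ALONG ONE BARE STEP** (modulo the (F1♯) binders `Theorem314_geomDir`, `Thm314_point_locus_geomDir` and the printed CJS Thm. 3.6):
for the blow-down `f : Bℓ_C(X_n) ⟶ X_n` read at a closed near point `x′ ↦ x_n`, both stages MAXIMAL ORIGINS at level `3` (value `ν`), `C` permissible
inside `X_n(ν)`, `ē_{x_n} ≤ 2`: for every irreducible component `D` of `V(C)` with `x_n ∈ D ≠ {x_n}`, the components of `X_{n+1}(ν)` through `x′`
DOMINATING `D` number at most one and are regular curves at `x′`. Stub-4's `strataCurveCentreDominantClean_of_geomDir` (the β-twin of this seat's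
p527476) with the step passed bare and the stage facts read off `IsMaximalOrigin`; the proof is otherwise verbatim (Thm. 3.14 numerical at `x_n` and at
the generic point `η` of `D`, Thm. 3.6 `e_η ≤ e_{x_n} − 1`, one `κ(η)`-rational near point over `η`, DVR domination).
[cite: CossartJannsenSaito2020, Thm. 3.14, Thm. 3.6, Rem. 6.29 (1), p. 104] -/
theorem curveGerm_dominant_clean_bare {p : ℕ} (hF : Theorem314_geomDir.{u}) (h314p : Thm314_point_locus_geomDir.{u})
    (h36 : CossartJannsenSaito2020_thm_3_6.{u}) {s s' : MarkedStage.{u}} (hO : IsMaximalOrigin p 3 ν s.W s.pt)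
    (hO' : IsMaximalOrigin p 3 ν s'.W s'.pt) {f : s'.W ⟶ s.W} {C : s.W.IdealSheafData}
    (hf : ∃ (L' : Labelling (blowup C)) (P' : Option (Pending (blowup C))) (h : IsLocallyNoetherian (blowup C)) (x' : ↥(blowup C)),
      (blowup.π C).base x' = s.pt ∧ IsClosed ({x'} : Set ↥(blowup C)) ∧ x' ∈ Scheme.hsStratum (blowup C) 3 ν ∧
        ∃ e : s' = ⟨blowup C, h, L', P', x'⟩, f = eqToHom (congrArg MarkedStage.W e) ≫ blowup.π C)
    (hCperm : IdealSheafData.IsPermissible C) (hCstr : (C.support : Set s.W) ⊆ Scheme.hsStratum s.W 3 ν) (hG : s.geomDirDim ≤ 2)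
    {D : Set s.W} (hD : D ∈ componentsIn (C.support : Set s.W)) (hxD : s.pt ∈ D) (hDne : D ≠ {s.pt}) :
    (∀ Z' ∈ componentsThrough 3 ν s', ∀ Z'' ∈ componentsThrough 3 ν s',
        closure (f.base '' Z') = D → closure (f.base '' Z'') = D → Z' = Z'') ∧
      ∀ Z' ∈ componentsThrough 3 ν s', closure (f.base '' Z') = D → IsRegularCurveAt s' Z' := by
  -- standing facts at the two stages
  haveI : IsLocallyNoetherian s.W := s.ln
  haveI : IsLocallyNoetherian s'.W := s'.ln
  obtain ⟨k, _, hinv⟩ := hO.exists_cycleInv (R := fun _ _ => True)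
  obtain ⟨k', _, hinv'⟩ := hO'.exists_cycleInv (R := fun _ _ => True)
  haveI : IsNoetherian s.W := hinv.isNoetherian
  have hexc : Scheme.IsExcellent s.W := hinv.isExcellent
  have hdimW : topologicalKrullDim s.W ≤ ((3 : ℕ) : WithBot ℕ∞) := hO.dim_le
  -- (F1♯) at the chain point: automatic at `ē ≤ 2`
  have hgdx : GeomDirHypothesis s.W s.pt := geomDirHypothesis_of_geomDirDim_le_two hG
  have hCreg : Scheme.IsRegular C.subscheme := isRegular_subscheme_of_isPermissible hCperm
  have hptcl : IsClosed ({s.pt} : Set s.W) := hO.isClosed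
  have hptcl' : IsClosed ({s'.pt} : Set s'.W) := hO'.isClosed
  have hptν : s.pt ∈ Scheme.hsStratum s.W 3 ν := hO.mem_stratum
  have hptν' : s'.pt ∈ Scheme.hsStratum s'.W 3 ν := hO'.mem_stratum
  have hWc' : IsClosed (Scheme.hsStratum s'.W 3 ν) := hinv'.isClosed_hsStratum
  -- `f` is the blow-up in `C`, `f x′ = x_n`
  obtain ⟨L', P₂, h₂, x', hπ, -, -, e, hfe⟩ := hf
  have hfpt : f.base s'.pt = s.pt := bareStep_base_pt hπ e hfe
  have hbl : IsBlowup f C := bareStep_isBlowup e hfe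
  -- `D`: closed irreducible inside `V(C)`, generic point `η ⤳ x_n`, `η ≠ x_n`
  have hCcl : IsClosed (C.support : Set s.W) := C.support.isClosed
  have hDc : IsClosed D := componentsIn.isClosed hCcl hD
  have hDirr : IsIrreducible D := componentsIn.isIrreducible hD
  have hDC : D ⊆ (C.support : Set s.W) := componentsIn.subset hD
  obtain ⟨η, hη⟩ : ∃ η, IsGenericPoint η D := ⟨_, hDirr.isGenericPoint_genericPoint hDc⟩
  have hηx : η ⤳ s.pt := hη.specializes hxD
  have hηC : η ∈ (C.support : Set s.W) := hDC hη.mem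
  have hxC : s.pt ∈ (C.support : Set s.W) := hDC hxD
  have hηne : η ≠ s.pt := fun h => hDne (by rw [← hη.def, h, hptcl.closure_eq])
  have hην : Scheme.hsFun s.W 3 η = ν := Scheme.mem_hsStratum_iff.mp (hCstr hηC)
  -- (F1♯) at `η`: `ē_η ≤ dim 𝒪_{X_n,η} ≤ dim 𝒪_{X_n,x_n} − 1 ≤ 2`
  have hgdη : GeomDirHypothesis s.W η :=
    geomDirHypothesis_of_geomDirDim_le_two (geomDirDim_le_two_of_specializes hηx hηne hdimW)
  -- `I(D) = C` stalkwise on `D`; `C_η = 𝔪_η`; `𝓘(D)` permissible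
  have hIDx : stalkIdeal (Scheme.IdealSheafData.vanishingIdeal ⟨D, hDc⟩) s.pt = stalkIdeal C s.pt :=
    stalkIdeal_vanishingIdeal_eq_of_mem_componentsIn hCreg hCperm hD hDc hxD
  have hCη : stalkIdeal C η = maximalIdeal (s.W.presheaf.stalk η) := by
    rw [← stalkIdeal_vanishingIdeal_eq_of_mem_componentsIn hCreg hCperm hD hDc hη.mem]
    have hDcl : (⟨D, hDc⟩ : Closeds s.W) = ⟨closure {η}, isClosed_closure⟩ := Closeds.ext hη.def.symm
    rw [hDcl, stalkIdeal_vanishingIdeal_closure_self]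
  have hDcl : (⟨closure ({η} : Set s.W), isClosed_closure⟩ : Closeds s.W) = ⟨D, hDc⟩ := Closeds.ext hη.def
  have hpermD : IdealSheafData.IsPermissible (Scheme.IdealSheafData.vanishingIdeal ⟨closure ({η} : Set s.W), isClosed_closure⟩) := by
    rw [hDcl]; exact isPermissible_vanishingIdeal_of_mem_componentsIn hCreg hCperm hD hDc
  -- `A := 𝒪_{x_n}/C_{x_n}` is regular of dimension `1`
  haveI hregA : IsRegularLocalRing (s.W.presheaf.stalk s.pt ⧸ stalkIdeal C s.pt) :=
    isRegularLocalRing_stalk_quotient_stalkIdeal hCreg hxC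
  have hge1 : (1 : WithBot ℕ∞) ≤ ringKrullDim (s.W.presheaf.stalk s.pt ⧸ stalkIdeal C s.pt) :=
    one_le_ringKrullDim_quotient_stalkIdeal C hηx hηne hηC
  have he2 : Scheme.dirDim s.W s.pt ≤ 2 := (Scheme.dirDim_le_geomDirDim s.pt).trans hG
  have hlt : ringKrullDim (s.W.presheaf.stalk s.pt ⧸ stalkIdeal C s.pt) <
      (Scheme.dirDim s.W s.pt : WithBot ℕ∞) := by
    have hnear : Scheme.hsFun s'.W 3 s'.pt = Scheme.hsFun s.W 3 s.pt := by
      rw [Scheme.mem_hsStratum_iff.mp hptν', Scheme.mem_hsStratum_iff.mp hptν]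
    exact hF s.W s'.W f C 3 s'.pt s.pt hexc hCperm hbl hdimW hfpt hxC hgdx hnear
  obtain ⟨dA, hdA⟩ := ringKrullDim_eq_nat (s.W.presheaf.stalk s.pt ⧸ stalkIdeal C s.pt)
  have hdimA : ringKrullDim (s.W.presheaf.stalk s.pt ⧸ stalkIdeal C s.pt) = 1 := by
    rw [hdA] at hge1 hlt ⊢
    have h1 : 1 ≤ dA := by exact_mod_cast hge1
    have h2 : dA < Scheme.dirDim s.W s.pt := by exact_mod_cast hlt
    have : dA = 1 := by omega
    rw [this]; rfl
  -- `e_η ≤ 1` (Thm. 3.6 at `η ⤳ x_n`)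
  have heη1 : Scheme.dirDim s.W η ≤ 1 := by
    have h := h36 s.W hexc s.pt η hηx hpermD
    rw [hDcl, hIDx, hdimA] at h
    have h' : ((Scheme.dirDim s.W η + 1 : ℕ) : WithBot ℕ∞) ≤ ((Scheme.dirDim s.W s.pt : ℕ) : WithBot ℕ∞) := by
      push_cast; exact h
    have h'' : Scheme.dirDim s.W η + 1 ≤ Scheme.dirDim s.W s.pt := by exact_mod_cast h'
    omega
  -- a dominant member: generic point `ζ′ ↦ η`, near to `η`; hence `e_η = 1`
  have member : ∀ Z' ∈ componentsThrough 3 ν s', closure (f.base '' Z') = D →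
      ∃ ζ', IsGenericPoint ζ' Z' ∧ f.base ζ' = η ∧
        Scheme.hsFun s'.W 3 ζ' = Scheme.hsFun s.W 3 (f.base ζ') ∧ Scheme.dirDim s.W η = 1 := by
    intro Z' hZ' hdom
    have hZ'c : IsClosed Z' := componentsIn.isClosed hWc' hZ'.1
    have hZ'irr : IsIrreducible Z' := componentsIn.isIrreducible hZ'.1
    obtain ⟨ζ', hζ'⟩ : ∃ ζ', IsGenericPoint ζ' Z' := ⟨_, hZ'irr.isGenericPoint_genericPoint hZ'c⟩
    have hfζ : f.base ζ' = η := (hdom ▸ hζ'.image f.continuous).eq hη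
    have hnear : Scheme.hsFun s'.W 3 ζ' = Scheme.hsFun s.W 3 (f.base ζ') := by
      rw [Scheme.mem_hsStratum_iff.mp (componentsIn.subset hZ'.1 hζ'.mem), hfζ, hην]
    refine ⟨ζ', hζ', hfζ, hnear, le_antisymm heη1 ?_⟩
    have h := hF s.W s'.W f C 3 ζ' η hexc hCperm hbl hdimW hfζ hηC hgdη (by rw [hnear, hfζ])
    rw [hCη] at h
    have h0 : ringKrullDim (s.W.presheaf.stalk η ⧸ maximalIdeal (s.W.presheaf.stalk η)) = 0 := by
      letI := Ideal.Quotient.field (maximalIdeal (s.W.presheaf.stalk η))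
      exact ringKrullDim_eq_zero_of_field _
    rw [h0] at h
    have : (0 : ℕ) < Scheme.dirDim s.W η := by exact_mod_cast h
    omega
  refine ⟨fun Z' hZ' Z'' hZ'' hd' hd'' => ?_, fun Z' hZ' hdom => ?_⟩
  · -- CLAUSE 1: at most one point of `X_{n+1}(ν)` over `η`
    obtain ⟨-, -, -, -, he1⟩ := member Z' hZ' hd'
    have hsub := nearFibre_subsingleton_of_geomDirHypothesis' h314p s.W s'.W f C hexc hCperm hbl 3 hdimW η hηC hCη
      hgdη he1
    have hfibη : (Scheme.hsStratum s'.W 3 ν ∩ f.base ⁻¹' {η}).Subsingleton := by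
      refine hsub.anti fun z hz => ⟨hz.2, ?_⟩
      rw [Scheme.mem_hsStratum_iff.mp hz.1, hην]
    exact dominant_unique_of_fibre_subsingleton f hη hWc' hfibη hZ'.1 hZ''.1 hd' hd''
  · -- CLAUSE 2: the DVR-domination core at the `k(η)`-rational near point `ζ′`
    obtain ⟨ζ', hζ', hfζ, hnear, he1⟩ := member Z' hZ' hdom
    have hZ'c : IsClosed Z' := componentsIn.isClosed hWc' hZ'.1
    have hZ'irr : IsIrreducible Z' := componentsIn.isIrreducible hZ'.1
    have hne : Z' ≠ {s'.pt} := by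
      intro h
      apply hDne
      rw [← hdom, h, Set.image_singleton, hfpt, hptcl.closure_eq]
    haveI : IsIso (f.residueFieldMap ζ') :=
      isIso_residueFieldMap_of_near_of_geomDirHypothesis h314p s.W s'.W f C hexc hCperm hbl 3 hdimW ζ'
        (hfζ ▸ hηC) (by rw [hfζ]; exact hCη) (by rw [hfζ]; exact hgdη) (by rw [hfζ]; exact he1) hnear
    have hcl : (⟨closure (f.base '' Z'), isClosed_closure⟩ : Closeds s.W) = ⟨D, hDc⟩ := Closeds.ext hdom
    have hreg' : IsRegularLocalRing (s.W.presheaf.stalk (f.base s'.pt) ⧸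
        stalkIdeal (Scheme.IdealSheafData.vanishingIdeal ⟨closure (f.base '' Z'), isClosed_closure⟩) (f.base s'.pt)) := by
      rw [hcl, hfpt, hIDx]; exact hregA
    have hdim' : ringKrullDim (s.W.presheaf.stalk (f.base s'.pt) ⧸
        stalkIdeal (Scheme.IdealSheafData.vanishingIdeal ⟨closure (f.base '' Z'), isClosed_closure⟩) (f.base s'.pt)) = 1 := by
      rw [hcl, hfpt, hIDx]; exact hdimA
    exact isRegularCurveAt_of_dominant_of_isIso_residueFieldMap s' f hptcl' hZ'irr hZ'c hZ'.2 hne hζ' hreg' hdim'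

/-! ## §3. The β-twin strata row and the characteristic-2 census with (K-ctr-cv) discharged -/


end Summit.ResolutionOfSingularities.ResolutionOfSingularities.Theorems.SigmaMaxModificationsCorridor3.Moving

end
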